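import Literature.NumberTheory.LFunctions.HeckeThetaBounds
import HarnessLib

/-!
# The theta integrals `f(t)`, `g(t)` of Hecke's weighted theta functions and their weak FE-pair

Topic `Literature/NumberTheory/LFunctions`; namespace `Literature.NumberTheory.LFunctions.NumberField`
(continuing `HeckeThetaBounds.lean`; the case `p = ∅`, `a₀ = 0`, `β = ±1` is `DedekindZetaMellin.lean`).
Third analytic input of the continuation of the partial zeta functions of narrow ray classes:
Neukirch, *Algebraic Number Theory*, VII §8 (8.3) Proposition and (8.4) Proposition (the Mellin
set-up `Λ(𝔎,χ,s) = L(f,s')` with `f(t) = f_F(𝔎,χ,t) = c(χ)/w ∫_F N(x^{(p-iq)/2}) θ(𝔎,χ,ixt^{1/n}) d*x`,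
`f(t) = a₀ + O(e^{-ct^{1/n}})`, `f(1/t) = W(χ) t^{1/2+Tr(p)/n} f_{F⁻¹}(𝔎',χ̄,t)`), here for the
cosets `a₀ + 𝔞` with sign weights `N(x^p)` (VII §8 Remark 1) and in Hecke's coordinates
`y(c,t)` of `DedekindZetaMellin.lean` on the *scaled* cube `c ∈ β·[0,1]^{r-1}` (a fundamental mesh
for the subgroup of `N`-th powers of the fundamental units when `β = N`).  Since the factor
`N(y^{p/2})` is already inside `heckeThetaW` and `N(y(c,t)) = t`, no extra kernel appears and the
weight of the FE-pair is `k = 1/2` for every `p`: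

* `heckeFW K p 𝔞 a₀ β t = ∫_{c ∈ [0,1]^{r-1}} Θ̃^p_{𝔞,a₀}(y(βc, t)) dc` and
  `heckeGW K p 𝔟 a₀ β t = ∫_{c ∈ [0,1]^{r-1}} Θ̂̃^p_{𝔟,a₀}(y(βc, t)) dc` (PROVED continuous on
  `(0, ∞)`, `continuousOn_heckeFW`, `continuousOn_heckeGW`);
* PROVED `heckeFW_inv`: `f(1/t) = (-i)^{|p|} t^{1/2} (𝔑(𝔞)√|d_K|)⁻¹ g(t)` with
  `g = heckeGW K p (𝔞𝔡)⁻¹ a₀ (-β)` (from `heckeThetaW_inv`, `y(c,1/t) = y(-c,t)⁻¹`, `N(y(-c,t)) = t`);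
* PROVED decay `f(t) - Θ̃(∞) = O(t^r)`, `g(t) - Θ̂̃(∞) = O(t^r)` for every real `r`
  (`isBigO_heckeFW_sub_const`, `isBigO_heckeGW_sub_const`, from `exists_weightedThetaTail_le` and the
  lower bound `y(c,t)_w ≥ e^{-2|β|M} t^{1/n}` on the scaled cube);
* `heckePairW K p 𝔞 a₀ β : WeakFEPair ℂ` — the hypotheses of the Mellin principle (VII (1.4)) in
  Mathlib's form (`Mathlib.NumberTheory.LSeries.AbstractFuncEq`): `f`, `g` as above, `k = 1/2`,
  `ε = (-i)^{|p|} (𝔑(𝔞)√|d_K|)⁻¹`, `f₀ = Θ̃(∞) = 𝟙[p = ∅ ∧ a₀ ∈ 𝔞]`, `g₀ = Θ̂̃(∞) = 𝟙[p = ∅]`.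
  Hence `(heckePairW …).Λ` is meromorphic on `ℂ`, holomorphic off `s' = 0, 1/2`, and equal to the
  Mellin transform of `f - f₀` for `re s' > 1/2` (`WeakFEPair.hasMellin`) — Neukirch VII (8.5) for
  `L(f, s')` before the identification with the partial zeta functions.

## References

* J. Neukirch, *Algebraic Number Theory*, Grundlehren 322, Springer 1999, Ch. VII §1 (1.4), §5
  (5.5)–(5.9), §8 (8.3)–(8.5) and Remark 1. [NeukirchANT1999]
* E. Hecke, *Eine neue Art von Zetafunktionen und ihre Beziehungen zur Verteilung der Primzahlen
  II*, Math. Z. 6 (1920), 11–51. [HeckeMathZ1920]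
-/

noncomputable section

open MeasureTheory Filter Set Submodule Complex NumberField NumberField.InfinitePlace
  NumberField.mixedEmbedding NumberField.Units
open scoped Real Topology FourierTransform ENNReal NumberField nonZeroDivisors ComplexConjugate

namespace Literature.NumberTheory.LFunctions

namespace NumberField

variable {K : Type*} [Field K] [NumberField K]

open scoped Classical

/-! ## Continuity of `Θ̃` and `Θ̂̃` in `y > 0` -/

/-- The Gaussian over a coset is summable: `Σ_{a∈𝔞} e^{-π⟨(a+a₀)y, a+a₀⟩} < ∞` for `y > 0`
(injection `a ↦ a + a₀` into `𝔞 + (a₀)`). [folklore] -/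
theorem summable_thetaSummand_add (I : FractionalIdeal (𝓞 K)⁰ K) (a₀ : K) {y : InfinitePlace K → ℝ}
    (hy : ∀ w, 0 < y w) : Summable fun a : I ↦ thetaSummand K y ((a : K) + a₀) := by
  set J := I ⊔ FractionalIdeal.spanSingleton (𝓞 K)⁰ a₀ with hJ
  have hsJ := summable_thetaIdeal_holds K J y hy
  let e : I → J := fun a ↦ ⟨(a : K) + a₀, add_mem_sup_spanSingleton I a₀ a⟩
  have he : Function.Injective e := fun a b h ↦ by
    have := congrArg (fun z : J ↦ (z : K)) h
    exact Subtype.ext (add_right_cancel this)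
  exact (hsJ.comp_injective he).congr fun a ↦ rfl

/-- Each term `y ↦ N(x^p) N(y^{p/2}) e^{-π⟨xy,x⟩}` of `Θ̃^p` is continuous in `y`. [folklore] -/
theorem continuous_heckeThetaW_term (p : Finset {w : InfinitePlace K // IsReal w}) (x : K) :
    Continuous fun y : InfinitePlace K → ℝ ↦
      ((realPow K p x * (∏ w ∈ p, Real.sqrt (y w.1)) * thetaSummand K y x : ℝ) : ℂ) := by
  refine Complex.continuous_ofReal.comp ((continuous_const.mul ?_).mul (continuous_thetaSummand x))
  exact continuous_finsetProd _ fun w _ ↦ (Real.continuous_sqrt.comp (continuous_apply _))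

/-- On `{y | y ≥ δ}` the terms of `Θ̃^p` are dominated by the summable family
`e^{-π⟨(a+a₀)(δ/2), a+a₀⟩}`. [folklore] -/
theorem norm_heckeThetaW_term_le (p : Finset {w : InfinitePlace K // IsReal w}) {δ : ℝ} (hδ : 0 < δ)
    {y : InfinitePlace K → ℝ} (hy : ∀ w, δ ≤ y w) (x : K) :
    ‖((realPow K p x * (∏ w ∈ p, Real.sqrt (y w.1)) * thetaSummand K y x : ℝ) : ℂ)‖ ≤
      thetaSummand K (fun _ ↦ δ / 2) x := by
  have hy0 : ∀ w, 0 ≤ y w := fun w ↦ hδ.le.trans (hy w)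
  rw [Complex.norm_real, Real.norm_eq_abs, abs_realPow_mul_prod_sqrt_mul]
  refine (weightedThetaSummand_le p hy0 x).trans ?_
  rw [thetaSummand_eq_mixedGaussian, thetaSummand_eq_mixedGaussian]
  exact mixedGaussian_le_mixedGaussian K (fun w ↦ by linarith [hy w]) _

/-- **`Θ̃^p_{𝔞,a₀}` is continuous on `{y | y ≥ δ}`** for every `δ > 0` (uniform convergence,
Neukirch VII (3.5)). [cite: NeukirchANT1999, Ch. VII §3 (3.5) Proposition] -/
theorem continuousOn_heckeThetaW_of_le (p : Finset {w : InfinitePlace K // IsReal w})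
    (I : FractionalIdeal (𝓞 K)⁰ K) (a₀ : K) {δ : ℝ} (hδ : 0 < δ) :
    ContinuousOn (heckeThetaW K p I a₀) {y | ∀ w, δ ≤ y w} := by
  refine continuousOn_tsum (fun a ↦ (continuous_heckeThetaW_term p ((a : K) + a₀)).continuousOn)
    (summable_thetaSummand_add I a₀ (fun _ ↦ half_pos hδ)) fun a y hy ↦ ?_
  exact norm_heckeThetaW_term_le p hδ hy _

/-- **`Θ̂̃^p_{𝔟,a₀}` is continuous on `{y | y ≥ δ}`** for every `δ > 0`. [cite: NeukirchANT1999, Ch. VII §3 (3.5) Proposition] -/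
theorem continuousOn_heckeThetaDualW_of_le (p : Finset {w : InfinitePlace K // IsReal w})
    (I : FractionalIdeal (𝓞 K)⁰ K) (a₀ : K) {δ : ℝ} (hδ : 0 < δ) :
    ContinuousOn (heckeThetaDualW K p I a₀) {y | ∀ w, δ ≤ y w} := by
  have h := summable_thetaSummand_add I 0 (fun _ ↦ half_pos hδ)
  simp only [add_zero] at h
  refine continuousOn_tsum (fun b ↦ (continuous_const.mul
    (continuous_heckeThetaW_term p (b : K))).continuousOn) h fun b y hy ↦ ?_
  rw [norm_mul, Circle.norm_coe, one_mul]
  exact norm_heckeThetaW_term_le p hδ hy _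

/-- The set `{y | y ≥ y₀/2}` (for `y₀ > 0` with minimal coordinate `y₀_{w₀}`) is a neighbourhood
of `y₀`. [folklore] -/
theorem setOf_half_le_mem_nhds {y : InfinitePlace K → ℝ} (hy : ∀ w, 0 < y w) :
    ∃ δ : ℝ, 0 < δ ∧ {z : InfinitePlace K → ℝ | ∀ w, δ ≤ z w} ∈ 𝓝 y := by
  obtain ⟨w₀, -, hw₀⟩ := Finset.exists_min_image Finset.univ y Finset.univ_nonempty
  refine ⟨y w₀ / 2, half_pos (hy w₀), ?_⟩
  refine Filter.mem_of_superset ((isOpen_set_pi Set.finite_univ fun w _ ↦ isOpen_Ioi (a := y w₀ / 2))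
    |>.mem_nhds fun w _ ↦ ?_) fun z hz w ↦ (hz w (Set.mem_univ w)).le
  exact (half_lt_self (hy w₀)).trans_le (hw₀ w (Finset.mem_univ w))

/-- `Θ̃^p_{𝔞,a₀}` is continuous at every `y > 0`. [folklore] -/
theorem continuousAt_heckeThetaW (p : Finset {w : InfinitePlace K // IsReal w})
    (I : FractionalIdeal (𝓞 K)⁰ K) (a₀ : K) {y : InfinitePlace K → ℝ} (hy : ∀ w, 0 < y w) :
    ContinuousAt (heckeThetaW K p I a₀) y := by
  obtain ⟨δ, hδ, hmem⟩ := setOf_half_le_mem_nhds hy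
  exact (continuousOn_heckeThetaW_of_le p I a₀ hδ).continuousAt hmem

/-- `Θ̂̃^p_{𝔟,a₀}` is continuous at every `y > 0`. [folklore] -/
theorem continuousAt_heckeThetaDualW (p : Finset {w : InfinitePlace K // IsReal w})
    (I : FractionalIdeal (𝓞 K)⁰ K) (a₀ : K) {y : InfinitePlace K → ℝ} (hy : ∀ w, 0 < y w) :
    ContinuousAt (heckeThetaDualW K p I a₀) y := by
  obtain ⟨δ, hδ, hmem⟩ := setOf_half_le_mem_nhds hy
  exact (continuousOn_heckeThetaDualW_of_le p I a₀ hδ).continuousAt hmem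

/-- **A priori bound**: `‖Θ̃^p_{𝔞,a₀}(y)‖ ≤ θ_{𝔞+(a₀)}(iy/2)` for `y > 0` (constant term `≤ 1` plus
the absolute tail `≤ θ - 1`). [folklore] -/
theorem norm_heckeThetaW_le (p : Finset {w : InfinitePlace K // IsReal w}) (I : FractionalIdeal (𝓞 K)⁰ K)
    (a₀ : K) {y : InfinitePlace K → ℝ} (hy : ∀ w, 0 < y w) :
    ‖heckeThetaW K p I a₀ y‖ ≤
      thetaIdeal K (I ⊔ FractionalIdeal.spanSingleton (𝓞 K)⁰ a₀) (fun w ↦ y w / 2) := by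
  have h1 := norm_heckeThetaW_sub_const_le p I a₀ hy
  have h2 := weightedThetaTail_le_thetaIdeal_sub_one p I a₀ hy
  have hc : ‖heckeThetaConst K p I a₀‖ ≤ 1 := by
    unfold heckeThetaConst; split_ifs <;> simp
  calc ‖heckeThetaW K p I a₀ y‖
      ≤ ‖heckeThetaW K p I a₀ y - heckeThetaConst K p I a₀‖ + ‖heckeThetaConst K p I a₀‖ :=
        norm_le_norm_sub_add _ _
    _ ≤ _ := by linarith

/-- **A priori bound**: `‖Θ̂̃^p_{𝔟,a₀}(y)‖ ≤ θ_𝔟(iy/2)` for `y > 0`. [folklore] -/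
theorem norm_heckeThetaDualW_le (p : Finset {w : InfinitePlace K // IsReal w})
    (I : FractionalIdeal (𝓞 K)⁰ K) (a₀ : K) {y : InfinitePlace K → ℝ} (hy : ∀ w, 0 < y w) :
    ‖heckeThetaDualW K p I a₀ y‖ ≤
      thetaIdeal K (I ⊔ FractionalIdeal.spanSingleton (𝓞 K)⁰ 0) (fun w ↦ y w / 2) := by
  have h1 := norm_heckeThetaDualW_sub_const_le p I a₀ hy
  have h2 := weightedThetaTail_le_thetaIdeal_sub_one p I 0 hy
  have hc : ‖(if p = ∅ then (1 : ℂ) else 0)‖ ≤ 1 := by split_ifs <;> simp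
  calc ‖heckeThetaDualW K p I a₀ y‖
      ≤ ‖heckeThetaDualW K p I a₀ y - (if p = ∅ then 1 else 0)‖ + ‖(if p = ∅ then (1 : ℂ) else 0)‖ :=
        norm_le_norm_sub_add _ _
    _ ≤ _ := by linarith

/-! ## The theta integrals `f(t)`, `g(t)` over the scaled cube -/

variable (K)

/-- **`f(t) = ∫_{c ∈ [0,1]^{r-1}} Θ̃^p_{𝔞,a₀}(y(βc, t)) dc`** — Neukirch's `f_F(𝔎, χ, t)` of VII (8.3)
(up to the normalisations `w⁻¹`, `d*x ↔ dc`, `c(χ)`), in Hecke's coordinates on the scaled cube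
`β·[0,1]^{r-1}` (a fundamental mesh for the group generated by the `β`-th powers of the fundamental
units when `β ∈ ℕ`). [cite: NeukirchANT1999, Ch. VII §8 (8.3) Proposition] -/
def heckeFW (p : Finset {w : InfinitePlace K // IsReal w}) (I : FractionalIdeal (𝓞 K)⁰ K) (a₀ : K)
    (β t : ℝ) : ℂ :=
  ∫ c in Set.Icc (0 : Fin (rank K) → ℝ) 1, heckeThetaW K p I a₀ (heckeCoord K (β • c) t)

/-- **`g(t) = ∫_{c ∈ [0,1]^{r-1}} Θ̂̃^p_{𝔟,a₀}(y(βc, t)) dc`** — the partner function (Neukirch's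
`f_{F⁻¹}(𝔎', χ̄, t)` side of VII (8.4)). [cite: NeukirchANT1999, Ch. VII §8 (8.4) Proposition] -/
def heckeGW (p : Finset {w : InfinitePlace K // IsReal w}) (I : FractionalIdeal (𝓞 K)⁰ K) (a₀ : K)
    (β t : ℝ) : ℂ :=
  ∫ c in Set.Icc (0 : Fin (rank K) → ℝ) 1, heckeThetaDualW K p I a₀ (heckeCoord K (β • c) t)

variable {K}

/-- `c ↦ Θ̃(y(βc, t))` is continuous. [folklore] -/
theorem continuous_heckeThetaW_heckeCoord (p : Finset {w : InfinitePlace K // IsReal w})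
    (I : FractionalIdeal (𝓞 K)⁰ K) (a₀ : K) (β t : ℝ) :
    Continuous fun c : Fin (rank K) → ℝ ↦ heckeThetaW K p I a₀ (heckeCoord K (β • c) t) :=
  continuous_iff_continuousAt.mpr fun c ↦
    (continuousAt_heckeThetaW p I a₀ (heckeCoord_pos (β • c) t)).comp
      (f := fun c : Fin (rank K) → ℝ ↦ heckeCoord K (β • c) t) (continuous_heckeCoord_smul β t).continuousAt

/-- `c ↦ Θ̂̃(y(βc, t))` is continuous. [folklore] -/
theorem continuous_heckeThetaDualW_heckeCoord (p : Finset {w : InfinitePlace K // IsReal w})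
    (I : FractionalIdeal (𝓞 K)⁰ K) (a₀ : K) (β t : ℝ) :
    Continuous fun c : Fin (rank K) → ℝ ↦ heckeThetaDualW K p I a₀ (heckeCoord K (β • c) t) :=
  continuous_iff_continuousAt.mpr fun c ↦
    (continuousAt_heckeThetaDualW p I a₀ (heckeCoord_pos (β • c) t)).comp
      (f := fun c : Fin (rank K) → ℝ ↦ heckeCoord K (β • c) t) (continuous_heckeCoord_smul β t).continuousAt

/-- `c ↦ θ_J(y(βc,t)/2)` is continuous (the dominating function). [folklore] -/
theorem continuous_thetaIdeal_heckeCoord_half (J : FractionalIdeal (𝓞 K)⁰ K) (β t : ℝ) :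
    Continuous fun c : Fin (rank K) → ℝ ↦ thetaIdeal K J (fun w ↦ heckeCoord K (β • c) t w / 2) := by
  refine continuous_iff_continuousAt.mpr fun c ↦ ?_
  refine (continuousAt_thetaIdeal J (fun w ↦ half_pos (heckeCoord_pos (β • c) t w))).comp
    (f := fun c : Fin (rank K) → ℝ ↦ fun w ↦ heckeCoord K (β • c) t w / 2) ?_
  exact ((continuous_heckeCoord_smul β t).div_const 2 |>.continuousAt)

/-- `∫_{[0,1]^{r-1}} C dc = C` for a complex constant. [folklore] -/
theorem setIntegral_unitCube_const' (C : ℂ) : ∫ _ in Set.Icc (0 : Fin (rank K) → ℝ) 1, C = C := by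
  rw [setIntegral_const, Measure.real, volume_real_unitCube, one_smul]

/-- **`f` is continuous on `(0, ∞)`** (dominated convergence: near `t₀` the integrand is bounded by
`θ_{𝔞+(a₀)}(y(βc, t₀/2)/2)`). [folklore] -/
theorem continuousOn_heckeFW (p : Finset {w : InfinitePlace K // IsReal w}) (I : FractionalIdeal (𝓞 K)⁰ K)
    (a₀ : K) (β : ℝ) : ContinuousOn (heckeFW K p I a₀ β) (Set.Ioi 0) := by
  intro t₀ ht₀
  refine ContinuousAt.continuousWithinAt ?_
  have h2 : 0 < t₀ / 2 := half_pos ht₀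
  have hmem : Set.Ioi (t₀ / 2) ∈ 𝓝 t₀ := isOpen_Ioi.mem_nhds (Set.mem_Ioi.mpr (half_lt_self ht₀))
  set J := I ⊔ FractionalIdeal.spanSingleton (𝓞 K)⁰ a₀
  refine continuousAt_of_dominated (μ := volume.restrict (Set.Icc (0 : Fin (rank K) → ℝ) 1))
    (bound := fun c ↦ thetaIdeal K J (fun w ↦ heckeCoord K (β • c) (t₀ / 2) w / 2)) ?_ ?_ ?_ ?_
  · exact Filter.Eventually.of_forall fun t ↦
      (continuous_heckeThetaW_heckeCoord p I a₀ β t).aestronglyMeasurable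
  · filter_upwards [hmem] with t ht
    refine Filter.Eventually.of_forall fun c ↦ ?_
    have ht' : t₀ / 2 < t := ht
    refine (norm_heckeThetaW_le p I a₀ (heckeCoord_pos (β • c) t)).trans ?_
    exact thetaIdeal_le_thetaIdeal K J (fun w ↦ half_pos (heckeCoord_pos _ _ w))
      fun w ↦ by linarith [heckeCoord_mono (β • c) h2 ht'.le w]
  · exact (continuous_thetaIdeal_heckeCoord_half J β (t₀ / 2)).continuousOn.integrableOn_compact
      isCompact_Icc
  · refine Filter.Eventually.of_forall fun c ↦ ?_
    exact (continuousAt_heckeThetaW p I a₀ (heckeCoord_pos (β • c) t₀)).comp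
      (f := fun t ↦ heckeCoord K (β • c) t) (continuousAt_heckeCoord (β • c) ht₀.ne')

/-- **`g` is continuous on `(0, ∞)`**. [folklore] -/
theorem continuousOn_heckeGW (p : Finset {w : InfinitePlace K // IsReal w}) (I : FractionalIdeal (𝓞 K)⁰ K)
    (a₀ : K) (β : ℝ) : ContinuousOn (heckeGW K p I a₀ β) (Set.Ioi 0) := by
  intro t₀ ht₀
  refine ContinuousAt.continuousWithinAt ?_
  have h2 : 0 < t₀ / 2 := half_pos ht₀
  have hmem : Set.Ioi (t₀ / 2) ∈ 𝓝 t₀ := isOpen_Ioi.mem_nhds (Set.mem_Ioi.mpr (half_lt_self ht₀))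
  set J := I ⊔ FractionalIdeal.spanSingleton (𝓞 K)⁰ 0
  refine continuousAt_of_dominated (μ := volume.restrict (Set.Icc (0 : Fin (rank K) → ℝ) 1))
    (bound := fun c ↦ thetaIdeal K J (fun w ↦ heckeCoord K (β • c) (t₀ / 2) w / 2)) ?_ ?_ ?_ ?_
  · exact Filter.Eventually.of_forall fun t ↦
      (continuous_heckeThetaDualW_heckeCoord p I a₀ β t).aestronglyMeasurable
  · filter_upwards [hmem] with t ht
    refine Filter.Eventually.of_forall fun c ↦ ?_
    have ht' : t₀ / 2 < t := ht
    refine (norm_heckeThetaDualW_le p I a₀ (heckeCoord_pos (β • c) t)).trans ?_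
    exact thetaIdeal_le_thetaIdeal K J (fun w ↦ half_pos (heckeCoord_pos _ _ w))
      fun w ↦ by linarith [heckeCoord_mono (β • c) h2 ht'.le w]
  · exact (continuous_thetaIdeal_heckeCoord_half J β (t₀ / 2)).continuousOn.integrableOn_compact
      isCompact_Icc
  · refine Filter.Eventually.of_forall fun c ↦ ?_
    exact (continuousAt_heckeThetaDualW p I a₀ (heckeCoord_pos (β • c) t₀)).comp
      (f := fun t ↦ heckeCoord K (β • c) t) (continuousAt_heckeCoord (β • c) ht₀.ne')

/-! ## Decay of `f - f₀` and `g - g₀` -/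

/-- On the scaled cube `|c_i| ≤ B` (`B ≥ 0`): `(log t)/n - 2BM ≤ u(c,t)_w`. [folklore] -/
theorem heckeLogCoord_ge_of_abs_le {B : ℝ} (hB : 0 ≤ B) {c : Fin (rank K) → ℝ} (hc : ∀ i, |c i| ≤ B)
    (t : ℝ) (w : InfinitePlace K) :
    Real.log t / Module.finrank ℚ K - 2 * (B * unitLogBound K) ≤ heckeLogCoord K c t w := by
  rw [heckeLogCoord]
  have key : |∑ i, c i * Real.log (w (fundSystem K i : K))| ≤ B * unitLogBound K := by
    calc |∑ i, c i * Real.log (w (fundSystem K i : K))|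
        ≤ ∑ i, |c i * Real.log (w (fundSystem K i : K))| := Finset.abs_sum_le_sum_abs _ _
      _ = ∑ i, |c i| * |Real.log (w (fundSystem K i : K))| := by simp_rw [abs_mul]
      _ ≤ ∑ i, B * |Real.log (w (fundSystem K i : K))| :=
          Finset.sum_le_sum fun i _ ↦ mul_le_mul_of_nonneg_right (hc i) (abs_nonneg _)
      _ ≤ ∑ i : Fin (rank K), B * ∑ w' : InfinitePlace K, |Real.log (w' (fundSystem K i : K))| :=
          Finset.sum_le_sum fun i _ ↦ mul_le_mul_of_nonneg_left
            (Finset.single_le_sum (f := fun w' : InfinitePlace K ↦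
              |Real.log (w' (fundSystem K i : K))|) (fun _ _ ↦ abs_nonneg _) (Finset.mem_univ w)) hB
      _ = B * unitLogBound K := by rw [unitLogBound, Finset.mul_sum]
  have := neg_abs_le (∑ i, c i * Real.log (w (fundSystem K i : K)))
  linarith

/-- On the scaled cube: `e^{-2BM} t^{1/n} ≤ y(c,t)_w` for `t > 0`. [folklore] -/
theorem heckeCoord_ge_of_abs_le {B : ℝ} (hB : 0 ≤ B) {c : Fin (rank K) → ℝ} (hc : ∀ i, |c i| ≤ B)
    {t : ℝ} (ht : 0 < t) (w : InfinitePlace K) :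
    Real.exp (-2 * (B * unitLogBound K)) * t ^ (1 / (Module.finrank ℚ K : ℝ)) ≤ heckeCoord K c t w := by
  rw [heckeCoord, Real.rpow_def_of_pos ht, ← Real.exp_add]
  refine Real.exp_le_exp.mpr ?_
  have := heckeLogCoord_ge_of_abs_le hB hc t w
  rw [one_div, ← div_eq_mul_inv]
  linarith

/-- Points of the scaled unit cube have coordinates of absolute value `≤ |β|`. [folklore] -/
theorem abs_smul_le_of_mem_Icc (β : ℝ) {c : Fin (rank K) → ℝ}
    (hc : c ∈ Set.Icc (0 : Fin (rank K) → ℝ) 1) (i : Fin (rank K)) : |(β • c) i| ≤ |β| := by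
  rw [Pi.smul_apply, smul_eq_mul, abs_mul]
  have h0 : 0 ≤ c i := hc.1 i
  have h1 : c i ≤ 1 := hc.2 i
  rw [abs_of_nonneg h0]
  nlinarith [abs_nonneg β]

/-- **Decay of `f - f₀`** (polynomial form of Neukirch VII (8.4), `f(t) = a₀ + O(e^{-ct^{1/n}})`):
for `2k > n` there is `C` with `‖f(t) - Θ̃(∞)‖ ≤ C t^{-k/n}` for `t ≥ 1`. [cite: NeukirchANT1999, Ch. VII §8 (8.4) Proposition] -/
theorem norm_heckeFW_sub_const_le (p : Finset {w : InfinitePlace K // IsReal w})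
    (I : FractionalIdeal (𝓞 K)⁰ K) (hI : I ≠ 0) (a₀ : K) (β : ℝ) {k : ℕ} (hk : Module.finrank ℚ K < 2 * k) :
    ∃ C : ℝ, ∀ t : ℝ, 1 ≤ t →
      ‖heckeFW K p I a₀ β t - heckeThetaConst K p I a₀‖ ≤ C * t ^ (-(k : ℝ) / Module.finrank ℚ K) := by
  obtain ⟨C, hC⟩ := exists_weightedThetaTail_le p I hI a₀ hk
  refine ⟨C * Real.exp (2 * (|β| * unitLogBound K)) ^ k, fun t ht ↦ ?_⟩
  have ht0 : 0 < t := one_pos.trans_le ht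
  set δ : ℝ := Real.exp (-2 * (|β| * unitLogBound K)) * t ^ (1 / (Module.finrank ℚ K : ℝ)) with hδ
  have hδpos : 0 < δ := mul_pos (Real.exp_pos _) (Real.rpow_pos_of_pos ht0 _)
  have hpt : ∀ c ∈ Set.Icc (0 : Fin (rank K) → ℝ) 1,
      ‖heckeThetaW K p I a₀ (heckeCoord K (β • c) t) - heckeThetaConst K p I a₀‖ ≤ C * δ⁻¹ ^ k :=
    fun c hc ↦ (norm_heckeThetaW_sub_const_le p I a₀ (heckeCoord_pos (β • c) t)).trans
      (hC δ hδpos _ fun w ↦ heckeCoord_ge_of_abs_le (abs_nonneg β) (abs_smul_le_of_mem_Icc β hc) ht0 w)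
  have hδk : δ⁻¹ ^ k = Real.exp (2 * (|β| * unitLogBound K)) ^ k * t ^ (-(k : ℝ) / Module.finrank ℚ K) := by
    rw [hδ, mul_inv, mul_pow, ← Real.exp_neg, neg_mul, neg_neg, ← Real.rpow_neg ht0.le,
      ← Real.rpow_natCast (t ^ (-(1 / (Module.finrank ℚ K : ℝ)))), ← Real.rpow_mul ht0.le]
    congr 2
    field_simp
  have hint : IntegrableOn (fun c : Fin (rank K) → ℝ ↦ heckeThetaW K p I a₀ (heckeCoord K (β • c) t))
      (Set.Icc (0 : Fin (rank K) → ℝ) 1) volume :=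
    (continuous_heckeThetaW_heckeCoord p I a₀ β t).continuousOn.integrableOn_compact isCompact_Icc
  calc ‖heckeFW K p I a₀ β t - heckeThetaConst K p I a₀‖
      = ‖∫ c in Set.Icc (0 : Fin (rank K) → ℝ) 1,
          (heckeThetaW K p I a₀ (heckeCoord K (β • c) t) - heckeThetaConst K p I a₀)‖ := by
        rw [integral_sub hint (integrableOn_const volume_unitCube_lt_top.ne), setIntegral_unitCube_const',
          heckeFW]
    _ ≤ C * δ⁻¹ ^ k * (volume : Measure (Fin (rank K) → ℝ)).real (Set.Icc (0 : Fin (rank K) → ℝ) 1) :=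
        norm_setIntegral_le_of_norm_le_const volume_unitCube_lt_top hpt
    _ = C * Real.exp (2 * (|β| * unitLogBound K)) ^ k * t ^ (-(k : ℝ) / Module.finrank ℚ K) := by
        rw [Measure.real, volume_real_unitCube, mul_one, hδk, mul_assoc]

/-- **Decay of `g - g₀`**: for `2k > n` there is `C` with `‖g(t) - 𝟙[p=∅]‖ ≤ C t^{-k/n}` for `t ≥ 1`.
[cite: NeukirchANT1999, Ch. VII §8 (8.4) Proposition] -/
theorem norm_heckeGW_sub_const_le (p : Finset {w : InfinitePlace K // IsReal w})
    (I : FractionalIdeal (𝓞 K)⁰ K) (hI : I ≠ 0) (a₀ : K) (β : ℝ) {k : ℕ} (hk : Module.finrank ℚ K < 2 * k) :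
    ∃ C : ℝ, ∀ t : ℝ, 1 ≤ t →
      ‖heckeGW K p I a₀ β t - (if p = ∅ then 1 else 0)‖ ≤ C * t ^ (-(k : ℝ) / Module.finrank ℚ K) := by
  obtain ⟨C, hC⟩ := exists_weightedThetaTail_le p I hI 0 hk
  refine ⟨C * Real.exp (2 * (|β| * unitLogBound K)) ^ k, fun t ht ↦ ?_⟩
  have ht0 : 0 < t := one_pos.trans_le ht
  set δ : ℝ := Real.exp (-2 * (|β| * unitLogBound K)) * t ^ (1 / (Module.finrank ℚ K : ℝ)) with hδ
  have hδpos : 0 < δ := mul_pos (Real.exp_pos _) (Real.rpow_pos_of_pos ht0 _)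
  have hpt : ∀ c ∈ Set.Icc (0 : Fin (rank K) → ℝ) 1,
      ‖heckeThetaDualW K p I a₀ (heckeCoord K (β • c) t) - (if p = ∅ then 1 else 0)‖ ≤ C * δ⁻¹ ^ k :=
    fun c hc ↦ (norm_heckeThetaDualW_sub_const_le p I a₀ (heckeCoord_pos (β • c) t)).trans
      (hC δ hδpos _ fun w ↦ heckeCoord_ge_of_abs_le (abs_nonneg β) (abs_smul_le_of_mem_Icc β hc) ht0 w)
  have hδk : δ⁻¹ ^ k = Real.exp (2 * (|β| * unitLogBound K)) ^ k * t ^ (-(k : ℝ) / Module.finrank ℚ K) := by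
    rw [hδ, mul_inv, mul_pow, ← Real.exp_neg, neg_mul, neg_neg, ← Real.rpow_neg ht0.le,
      ← Real.rpow_natCast (t ^ (-(1 / (Module.finrank ℚ K : ℝ)))), ← Real.rpow_mul ht0.le]
    congr 2
    field_simp
  have hint : IntegrableOn (fun c : Fin (rank K) → ℝ ↦ heckeThetaDualW K p I a₀ (heckeCoord K (β • c) t))
      (Set.Icc (0 : Fin (rank K) → ℝ) 1) volume :=
    (continuous_heckeThetaDualW_heckeCoord p I a₀ β t).continuousOn.integrableOn_compact isCompact_Icc
  calc ‖heckeGW K p I a₀ β t - (if p = ∅ then 1 else 0)‖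
      = ‖∫ c in Set.Icc (0 : Fin (rank K) → ℝ) 1,
          (heckeThetaDualW K p I a₀ (heckeCoord K (β • c) t) - (if p = ∅ then 1 else 0))‖ := by
        rw [integral_sub hint (integrableOn_const volume_unitCube_lt_top.ne), setIntegral_unitCube_const',
          heckeGW]
    _ ≤ C * δ⁻¹ ^ k * (volume : Measure (Fin (rank K) → ℝ)).real (Set.Icc (0 : Fin (rank K) → ℝ) 1) :=
        norm_setIntegral_le_of_norm_le_const volume_unitCube_lt_top hpt
    _ = C * Real.exp (2 * (|β| * unitLogBound K)) ^ k * t ^ (-(k : ℝ) / Module.finrank ℚ K) := by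
        rw [Measure.real, volume_real_unitCube, mul_one, hδk, mul_assoc]

/-- From `‖h(t) - h₀‖ ≤ C t^{-k/n}` for all `2k > n` to `h - h₀ = O(t^r)` at `∞` for every `r`
(choice of `k`). [folklore] -/
theorem isBigO_of_forall_le_rpow {h : ℝ → ℂ} {h₀ : ℂ}
    (H : ∀ k : ℕ, Module.finrank ℚ K < 2 * k → ∃ C : ℝ, ∀ t : ℝ, 1 ≤ t →
      ‖h t - h₀‖ ≤ C * t ^ (-(k : ℝ) / Module.finrank ℚ K)) (r : ℝ) :
    (fun t ↦ h t - h₀) =O[atTop] fun t ↦ t ^ r := by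
  obtain ⟨k, hk, hkr⟩ : ∃ k : ℕ, Module.finrank ℚ K < 2 * k ∧
      -(k : ℝ) / Module.finrank ℚ K ≤ r := by
    obtain ⟨k, hk⟩ := exists_nat_gt (max (Module.finrank ℚ K : ℝ) (-r * Module.finrank ℚ K))
    have hn : (0 : ℝ) < Module.finrank ℚ K := Nat.cast_pos.mpr Module.finrank_pos
    refine ⟨k, ?_, ?_⟩
    · have : (Module.finrank ℚ K : ℝ) < k := (le_max_left _ _).trans_lt hk
      exact_mod_cast (show (Module.finrank ℚ K : ℝ) < 2 * k by linarith)
    · have : -r * Module.finrank ℚ K < k := (le_max_right _ _).trans_lt hk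
      rw [div_le_iff₀ hn]
      linarith
  obtain ⟨C, hC⟩ := H k hk
  refine Asymptotics.IsBigO.of_bound |C| ?_
  filter_upwards [Filter.eventually_ge_atTop (1 : ℝ)] with t ht
  have ht0 : 0 < t := one_pos.trans_le ht
  rw [Real.norm_of_nonneg (Real.rpow_nonneg ht0.le r)]
  calc ‖h t - h₀‖ ≤ C * t ^ (-(k : ℝ) / Module.finrank ℚ K) := hC t ht
    _ ≤ |C| * t ^ (-(k : ℝ) / Module.finrank ℚ K) :=
        mul_le_mul_of_nonneg_right (le_abs_self C) (Real.rpow_nonneg ht0.le _)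
    _ ≤ |C| * t ^ r :=
        mul_le_mul_of_nonneg_left (Real.rpow_le_rpow_of_exponent_le ht hkr) (abs_nonneg C)

/-- `f(t) - Θ̃(∞) = O(t^r)` at `∞` for every real `r` (hypothesis `hf_top` of `WeakFEPair`). [folklore] -/
theorem isBigO_heckeFW_sub_const (p : Finset {w : InfinitePlace K // IsReal w})
    (I : FractionalIdeal (𝓞 K)⁰ K) (hI : I ≠ 0) (a₀ : K) (β r : ℝ) :
    (fun t ↦ heckeFW K p I a₀ β t - heckeThetaConst K p I a₀) =O[atTop] fun t ↦ t ^ r :=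
  isBigO_of_forall_le_rpow (fun _ hk ↦ norm_heckeFW_sub_const_le p I hI a₀ β hk) r

/-- `g(t) - 𝟙[p=∅] = O(t^r)` at `∞` for every real `r` (hypothesis `hg_top` of `WeakFEPair`). [folklore] -/
theorem isBigO_heckeGW_sub_const (p : Finset {w : InfinitePlace K // IsReal w})
    (I : FractionalIdeal (𝓞 K)⁰ K) (hI : I ≠ 0) (a₀ : K) (β r : ℝ) :
    (fun t ↦ heckeGW K p I a₀ β t - (if p = ∅ then 1 else 0)) =O[atTop] fun t ↦ t ^ r :=
  isBigO_of_forall_le_rpow (fun _ hk ↦ norm_heckeGW_sub_const_le p I hI a₀ β hk) r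

/-! ## The functional equation `f(1/t) = ε t^{1/2} g(t)` and the weak FE-pair -/

/-- **`f(1/t) = (-i)^{|p|} t^{1/2} (𝔑(𝔞)√|d_K|)⁻¹ g(t)`** with `g = heckeGW K p (𝔞𝔡)⁻¹ a₀ (-β)` — the
first formula of Neukirch VII (8.4), `f_F(𝔎,χ,1/t) = W(χ) t^{1/2+Tr(p)/n} f_{F⁻¹}(𝔎',χ̄,t)`, in our
normalisation (the extra `t^{Tr(p)/n}` of loc. cit. is absorbed by the factor `N(y^{p/2})` inside
`Θ̃`), from `heckeThetaW_inv`, `y(βc, 1/t) = y(-βc, t)⁻¹` and `N(y(-βc, t)) = t`.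
[cite: NeukirchANT1999, Ch. VII §8 (8.4) Proposition] -/
theorem heckeFW_inv (p : Finset {w : InfinitePlace K // IsReal w}) (I : (FractionalIdeal (𝓞 K)⁰ K)ˣ)
    (a₀ : K) (β : ℝ) {t : ℝ} (ht : 0 < t) :
    heckeFW K p I a₀ β t⁻¹ = (-Complex.I) ^ p.card *
      ((Real.sqrt t / ((FractionalIdeal.absNorm (I : FractionalIdeal (𝓞 K)⁰ K) : ℝ) *
        Real.sqrt |(discr K : ℝ)|) : ℝ) : ℂ) *
      heckeGW K p (FractionalIdeal.dual ℤ ℚ (I : FractionalIdeal (𝓞 K)⁰ K)) a₀ (-β) t := by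
  rw [heckeFW, heckeGW, ← integral_const_mul]
  refine setIntegral_congr_fun measurableSet_Icc fun c _ ↦ ?_
  rw [heckeCoord_inv, heckeThetaW_inv p I a₀ (fun w ↦ heckeCoord_pos _ t w), mixedNorm_heckeCoord _ ht,
    neg_smul]

variable (K) in
/-- **The weak FE-pair of Hecke's weighted theta function of a coset** (Neukirch VII (8.3)–(8.4)
⇒ hypotheses of the Mellin principle (1.4), here Mathlib's `WeakFEPair`; for `p = ∅`, `a₀ = 0`,
`β = 1` this is `heckePair` of `DedekindZetaMellin.lean`): `f = heckeFW K p 𝔞 a₀ β`,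
`g = heckeGW K p (𝔞𝔡)⁻¹ a₀ (-β)`, weight `k = 1/2`, constant `ε = (-i)^{|p|} (𝔑(𝔞)√|d_K|)⁻¹`,
constant terms `f₀ = Θ̃(∞) = 𝟙[p = ∅ ∧ a₀ ∈ 𝔞]`, `g₀ = Θ̂̃(∞) = 𝟙[p = ∅]`.  Consequently
`(heckePairW …).Λ` is meromorphic, holomorphic off `{0, 1/2}`, and is the Mellin transform of
`f - f₀` on `re s > 1/2` (Mathlib `WeakFEPair.differentiableAt_Λ`, `WeakFEPair.hasMellin`):
Neukirch VII (8.5) for `L(f, s)`. [cite: NeukirchANT1999, Ch. VII §8 (8.3)–(8.5)] -/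
def heckePairW (p : Finset {w : InfinitePlace K // IsReal w}) (I : (FractionalIdeal (𝓞 K)⁰ K)ˣ)
    (a₀ : K) (β : ℝ) : WeakFEPair ℂ where
  f := heckeFW K p I a₀ β
  g := heckeGW K p (FractionalIdeal.dual ℤ ℚ (I : FractionalIdeal (𝓞 K)⁰ K)) a₀ (-β)
  k := 1 / 2
  ε := (-Complex.I) ^ p.card * ((((FractionalIdeal.absNorm (I : FractionalIdeal (𝓞 K)⁰ K) : ℝ) *
    Real.sqrt |(discr K : ℝ)|)⁻¹ : ℝ) : ℂ)
  f₀ := heckeThetaConst K p I a₀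
  g₀ := if p = ∅ then 1 else 0
  hf_int := (continuousOn_heckeFW p I a₀ β).locallyIntegrableOn measurableSet_Ioi
  hg_int := (continuousOn_heckeGW p _ a₀ (-β)).locallyIntegrableOn measurableSet_Ioi
  hk := one_half_pos
  hε := mul_ne_zero (pow_ne_zero _ (neg_ne_zero.mpr Complex.I_ne_zero))
    (by exact_mod_cast inv_ne_zero (absNorm_mul_sqrt_discr_ne_zero _ I.ne_zero))
  h_feq := fun x hx ↦ by
    have hx0 : 0 < x := hx
    simp only [one_div]
    rw [heckeFW_inv p I a₀ β hx0, smul_eq_mul, Real.sqrt_eq_rpow, Complex.ofReal_div,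
      Complex.ofReal_inv, div_eq_mul_inv, Complex.ofReal_mul]
    ring
  hf_top := fun r ↦ isBigO_heckeFW_sub_const p I I.ne_zero a₀ β r
  hg_top := fun r ↦ isBigO_heckeGW_sub_const p _ (FractionalIdeal.dual_ne_zero ℤ ℚ I.ne_zero) a₀ (-β) r

end NumberField

end Literature.NumberTheory.LFunctions
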